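import Summits.Schanuel.Schanuel.Theses.TateNomes

/-!
# Line `trdeg-bookkeeping` for crux `NomeTransfer` — route `TateNomes` (item stmt-Schanuel-17405)

Crux-strategist `planner-cstrat-stmt-Schanuel-17405-b1-0`, 2026-08-17 (strategy before the lead).

TARGET (FIXED, concluded BY NAME): `Summit.Schanuel.Schanuel.Theses.TateNomes.NomeTransfer` —
for `z : Fin n → ℂ`, admissible `e : Fin k → ℂ` (each `eᵢ` or `exp eᵢ` algebraic over `ℚ`) and
`w : Fin (n+k) → ℂ` with `span_ℚ w = span_ℚ (z, e)`: if the envelope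
`Env(w) = ℚ(w, e^w, P(e^{wⱼ}), Q(e^{wⱼ}), R(e^{wⱼ}))` has `trdeg ≥ 4(n+k)` then `n ≤ trdeg ℚ(z, e^z)`.

TECHNIQUE (the one with teeth): transcendence-degree bookkeeping in `IntermediateField ℚ ℂ` —
(1) subadditivity of `trdeg` under adjunction of finitely many OPAQUE generators (the `3(n+k)` modular
values are never looked at), (2) SPAN DESCENT through `exp` (`s ∈ span_ℚ T ⇒ s ∈ ℚ(T)` and
`exp(s)^N` is a Laurent monomial in `exp T`, so `ℚ(S, e^S)` lies in the relative algebraic closure of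
`ℚ(T, e^T)`), (3) absorption of algebraic generators (`trdeg ℚ(X ∪ A) = trdeg ℚ(X)` for `A ⊆ ℚ̄`).
Write `t = trdeg ℚ(z, e^z)`, `T_w = trdeg ℚ(w, e^w)`, `T_ze = trdeg ℚ(z, e, e^z, e^e)`. Then
`4(n+k) ≤ trdeg Env(w) ≤ T_w + 3(n+k)` (stub 1), `T_w ≤ T_ze` (stub 2), `T_ze ≤ t + k` (stub 3), so
`4(n+k) ≤ t + k + 3(n+k)` in `Cardinal`; if `t ≥ ℵ₀` the goal `n ≤ t` is free, else it is `ℕ`-arithmetic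
(`cancel`, proved here). `LinearIndependent ℚ z` and the `⊇` half of the span equality are not used
(refuter crux-attack 2026-08-17: exactly admissibility (ii) and the envelope bound (iv) are load-bearing).

## The cut — three registered stubs, each a self-contained folklore lemma over Mathlib

* `stub_envelopeCount` (size S/M): `trdeg ℚ(S ∪ range f ∪ range g ∪ range h) ≤ trdeg ℚ(S) + 3m` for
  `f g h : Fin m → ℂ` — `trdeg_adjoin_union_le` ×3 + `trdeg_adjoin_le_mk` + `Cardinal.mk_range_le`
  (tree: `Literature.NumberTheory.Transcendental.trdeg_adjoin_union_le / trdeg_adjoin_le_mk`,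
  `RankOneGridTrdeg.lean`).
* `stub_spanDescent` (size M, LOAD-BEARING): `range w ⊆ span_ℚ(range z ∪ range e) ⇒ T_w ≤ T_ze` — the
  set-level lemma `trdeg_le_of_subset_span` (S ⊆ span_ℚ T ⇒ trdeg ℚ(S, exp S) ≤ trdeg ℚ(T, exp T))
  is PRIVATE but landed in `Theorems/DiophantineDichotomyKhovanskiiApproxTypeEvUnanchoring.lean`
  (with `mem_and_exp_mem_of_mem_span`); copy it, then `Set.image_union` + `Set.range_comp`.
* `stub_algPairCost` (size M): admissible pairs cost `≤ k`: with `bᵢ :=` the non-algebraic partner,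
  `range e ∪ range (exp ∘ e) ⊆ A ∪ range b` with `A ⊆ ℚ̄`, so `trdeg ℚ(z, e, e^z, e^e) ≤
  trdeg ℚ((z, e^z) ∪ range b ∪ A) = trdeg ℚ((z, e^z) ∪ range b) ≤ t + #range b ≤ t + k`
  (`trdeg_mono`, `trdeg_adjoin_union_eq_of_isAlgebraic`, `trdeg_adjoin_union_le`, `trdeg_adjoin_le_mk`).

COMPOSITION `NomeTransfer_of : NomeTransfer` (no `sorry` of its own; `sorryAx` enters only through the
three stubs): 8 lines of logic + `cancel`. FASTEST CLOSE for a lead: the grounder's sorry-free candidate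
proof of the whole crux is already attached to the item (evidence `TateNomesNomeTransfer.lean`,
grounder-ground-pool-g77-1, 2026-08-17T02:22:57Z, rc 0, audit closed) — land it as
`Theorems/TateNomesNomeTransfer.lean --workitem stmt-Schanuel-17405`; this skeleton is the registered
stub set (`--supports stmt-Schanuel-17405` files must prove one of the three verbatim) and the fallback.

Disproof used: none exists (`ledger crux ls stmt-Schanuel-17405`: no workfiles; no `Disproof.lean`).
Negatives (`ledger negatives --problem Schanuel`): 2 PolarPhantoms entries `¬ ∀ n y α, … trdeg ℚ(y, α) < n`
— unrelated shape; no stub is an instance (all three stubs are unconditional UPPER bounds on a trdeg).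
-/

-- D-0017: the doubled `Schanuel.Schanuel` path component trips dupNamespace
set_option linter.dupNamespace false

namespace Summit.Schanuel.Schanuel.Cruxes.NomeTransfer.TrdegBookkeeping

open Summit.Schanuel.Schanuel.Theses.TateNomes (NomeTransfer)

/-! ## Registered stubs (stated over Mathlib only) -/

/-- **STUB 1 — envelope count** (size S/M). Adjoining three `Fin m`-indexed families of complex
numbers to any set `S` raises the transcendence degree over `ℚ` by at most `3m`:
`trdeg ℚ(S ∪ range f ∪ range g ∪ range h) ≤ trdeg ℚ(S) + 3m`. Plan: `trdeg_adjoin_union_le`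
(tree, `RankOneGridTrdeg.lean`) three times, `trdeg_adjoin_le_mk` and `Cardinal.mk_range_le`
(`#(range f) ≤ #(Fin m) = m`), then cardinal arithmetic. In the crux `S = range w ∪ range (exp ∘ w)`
and `f, g, h` are the inline Ramanujan `P, Q, R` q-series at `q = e^{wⱼ}` (opaque here). [folklore] -/
theorem stub_envelopeCount :
    ∀ (m : ℕ) (S : Set ℂ) (f g h : Fin m → ℂ),
      Algebra.trdeg ℚ ↥(IntermediateField.adjoin ℚ (S ∪ Set.range f ∪ Set.range g ∪ Set.range h)) ≤
        Algebra.trdeg ℚ ↥(IntermediateField.adjoin ℚ S) + ((3 * m : ℕ) : Cardinal) := by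
  sorry

/-- **STUB 2 — span descent through `exp`** (size M; the load-bearing lemma of the line). If every
`wⱼ` lies in `span_ℚ (range z ∪ range e)` then `trdeg ℚ(w, e^w) ≤ trdeg ℚ(z, e, e^z, e^e)`:
`wⱼ ∈ ℚ(z, e)` and `exp(wⱼ)^N = ∏ exp(zᵢ)^{aᵢ} ∏ exp(eᵢ)^{bᵢ}` for a common denominator `N`, so
`ℚ(w, e^w)` lies in the relative algebraic closure of `L = ℚ(z, e, e^z, e^e)` in `ℂ`, whose
transcendence degree is `trdeg L`. Plan: the set-level statement
`S ⊆ span_ℚ T → trdeg ℚ(S ∪ exp '' S) ≤ trdeg ℚ(T ∪ exp '' T)` is landed (private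
`trdeg_le_of_subset_span`, `mem_and_exp_mem_of_mem_span` in
`Theorems/DiophantineDichotomyKhovanskiiApproxTypeEvUnanchoring.lean`: `Submodule.span_induction`,
`algebraicClosure`, `IsAlgebraic.of_pow`, `trdeg_mono`, `trdeg_le_of_isAlgebraic`); specialise to
`S = range w`, `T = range z ∪ range e` and rewrite `Set.image_union`, `← Set.range_comp`. [folklore] -/
theorem stub_spanDescent :
    ∀ (m n k : ℕ) (w : Fin m → ℂ) (z : Fin n → ℂ) (e : Fin k → ℂ),
      Set.range w ⊆ (Submodule.span ℚ (Set.range z ∪ Set.range e) : Set ℂ) →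
      Algebra.trdeg ℚ ↥(IntermediateField.adjoin ℚ (Set.range w ∪ Set.range (Complex.exp ∘ w))) ≤
        Algebra.trdeg ℚ ↥(IntermediateField.adjoin ℚ
          (Set.range z ∪ Set.range e ∪ (Set.range (Complex.exp ∘ z) ∪ Set.range (Complex.exp ∘ e)))) := by
  sorry

/-- **STUB 3 — admissible pairs cost at most one each** (size M). If each `eᵢ` or `exp eᵢ` is
algebraic over `ℚ` then `trdeg ℚ(z, e, e^z, e^e) ≤ trdeg ℚ(z, e^z) + k`. Plan: with
`bᵢ := if IsAlgebraic ℚ (e i) then exp (e i) else e i` and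
`A := {x ∈ range e ∪ range (exp ∘ e) | IsAlgebraic ℚ x}`, one has
`range e ∪ range (exp ∘ e) ⊆ A ∪ range b`, hence (with `Z = range z ∪ range (exp ∘ z)`)
`trdeg ℚ(Z ∪ range e ∪ range (exp ∘ e)) ≤ trdeg ℚ((Z ∪ range b) ∪ A) = trdeg ℚ(Z ∪ range b)
≤ trdeg ℚ(Z) + #(range b) ≤ trdeg ℚ(Z) + k` (`trdeg_mono` / `IntermediateField.adjoin.mono`,
`trdeg_adjoin_union_eq_of_isAlgebraic`, `trdeg_adjoin_union_le`, `trdeg_adjoin_le_mk`,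
`Cardinal.mk_range_le`; all in the tree / Mathlib). [folklore] -/
theorem stub_algPairCost :
    ∀ (n k : ℕ) (z : Fin n → ℂ) (e : Fin k → ℂ),
      (∀ i, IsAlgebraic ℚ (e i) ∨ IsAlgebraic ℚ (Complex.exp (e i))) →
      Algebra.trdeg ℚ ↥(IntermediateField.adjoin ℚ
          (Set.range z ∪ Set.range e ∪ (Set.range (Complex.exp ∘ z) ∪ Set.range (Complex.exp ∘ e)))) ≤
        Algebra.trdeg ℚ ↥(IntermediateField.adjoin ℚ (Set.range z ∪ Set.range (Complex.exp ∘ z))) +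
          (k : Cardinal) := by
  sorry

/-! ## Composition (sorry-free below this line) -/

/-- Cardinal cancellation used by the composition: from `4(n+k) ≤ t + k + 3(n+k)` conclude `n ≤ t`
(free if `t` is infinite, `ℕ`-arithmetic otherwise). -/
theorem cancel {t : Cardinal} {n k : ℕ}
    (h : ((4 * (n + k) : ℕ) : Cardinal) ≤ t + (k : Cardinal) + ((3 * (n + k) : ℕ) : Cardinal)) :
    (n : Cardinal) ≤ t := by
  rcases lt_or_ge t Cardinal.aleph0 with ht | ht
  · obtain ⟨m, rfl⟩ := Cardinal.lt_aleph0.1 ht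
    have h' : 4 * (n + k) ≤ m + k + 3 * (n + k) := by exact_mod_cast h
    have hnm : n ≤ m := by omega
    exact_mod_cast hnm
  · exact (Cardinal.natCast_lt_aleph0 (n := n)).le.trans ht

/-- The pure bookkeeping behind the crux, with the four transcendence degrees abstracted:
envelope bound + the three stub inequalities give `n ≤ t`. -/
theorem le_of_bounds {Tenv Tw Tze t : Cardinal} {n k : ℕ}
    (henv : ((4 * (n + k) : ℕ) : Cardinal) ≤ Tenv)
    (h₁ : Tenv ≤ Tw + ((3 * (n + k) : ℕ) : Cardinal)) (h₂ : Tw ≤ Tze)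
    (h₃ : Tze ≤ t + (k : Cardinal)) : (n : Cardinal) ≤ t :=
  cancel (henv.trans (h₁.trans (add_le_add (h₂.trans h₃) le_rfl)))

/-- **`NomeTransfer` from the three stubs** — concludes the route decl
`Summit.Schanuel.Schanuel.Theses.TateNomes.NomeTransfer` BY NAME; no `sorry` of its own
(`sorryAx` reaches it only through `stub_envelopeCount`, `stub_spanDescent`, `stub_algPairCost`). -/
theorem NomeTransfer_of : NomeTransfer := by
  intro n z k e w _hz he hspan henv
  have hw : Set.range w ⊆ (Submodule.span ℚ (Set.range z ∪ Set.range e) : Set ℂ) := by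
    intro x hx
    have hx' : x ∈ Submodule.span ℚ (Set.range w) := Submodule.subset_span hx
    rw [hspan] at hx'
    exact hx'
  have h₂ := stub_spanDescent (n + k) n k w z e hw
  have h₃ := stub_algPairCost n k z e he
  exact le_of_bounds henv (stub_envelopeCount (n + k) _ _ _ _) h₂ h₃

end Summit.Schanuel.Schanuel.Cruxes.NomeTransfer.TrdegBookkeeping
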